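import Summits.PneNP.PneNP.Theorems.RegularResolutionRung.Negative.EmptyGraphLines
import Literature.Computability.MetaComplexity.ResolutionProofs
import Summits.PneNP.PneNP.Theorems.RamseyUncertifiableResolutionUncertaintyCoreTransfer
import Summits.PneNP.PneNP.Theorems.RamseyUncertifiableResolutionUncertaintyRestrictRefutation
import Summits.PneNP.PneNP.Theorems.RamseyUncertifiableResolutionUncertaintyDRCStep
import Summits.PneNP.PneNP.Theorems.RamseyUncertifiableResolutionUncertaintyPromelRodl
import Summits.PneNP.PneNP.Theorems.RamseyUncertifiableResolutionUncertaintyHeavyBlockWidth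

/-!
# `ResolutionUncertainty` from bi-dense core hardness (the reduction, sorry-free)

Item `stmt-PneNP-9816` (`Summit.PneNP.PneNP.Theses.RamseyUncertifiable.ResolutionUncertainty`), support of
route `RamseyUncertifiable`; helper file (`--supports`), it does NOT close the item.

This file records in the tree, without `sorry`, the kernel-checked reduction of the item obtained on the
line `box-dag-self-gadget-lifting` (Cruxes/ResolutionUncertainty/Lines/box-dag-self-gadget-lifting.lean,
lead prover-line-stmt-PneNP-9816-0): the item FOLLOWS from ONE graph-theoretic/proof-complexity
hypothesis, *bi-dense core hardness* — every resolution refutation of the unary `Clique(H, k)`,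
`k ≤ 3 log₂ m`, over a graph `H` on `Fin m` that is two-sidedly `δ`-dense between all disjoint vertex
sets of size `≥ m^{1-β}` has length `≥ m^{ε log₂ m}` for some `ε = ε(β, δ) > 0`. The hypothesis is
stated INLINE (no new definition); it contains the open problem of Atserias–Bonacina–de Rezende–
Lauria–Nordström–Razborov (arXiv:2012.09476 §9) and Lauria–Pudlák–Rödl–Thapen (arXiv:1303.3166 §1.1)
— dag-like resolution of `Clique(G(m,½), 2 log₂ m)` — so the theorem is a conditional reduction, not a
proof of the item.

Everything else on the path is PROVED and imported:
* `stub_drcStep` (dependent random choice + Erdős–Szekeres) and `stub_promelRodl` (the Prömel–Rödl /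
  LPRT Lemma 11 core of a 2-Ramsey graph: `|S| ≥ n^{3/4}`, two-sided `δ`-density between disjoint
  `|S|^{1-β}`-subsets), `stub_coreTransfer` (re-indexing the core as a graph on `Fin m`, `n³ ≤ m⁴`),
  `stub_restrictRefutation` (ABdRLNR Fact 3.2: restricting a refutation to an induced subgraph does not
  lengthen it);
* here: satisfiability of `cliqueCNF` on a clique (`satisfiable_cliqueCNF_of_clique`), hence soundness
  `cliqueFree_of_refutation` (a refuted `Clique(G,k)` forces `G` to be `K_k`-free), and the composition
  `resolutionUncertainty_of_biDenseCoreHardness` with the exponent bookkeeping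
  `n^{(9/16)ε' log₂ n} ≤ m^{ε' log₂ m}` for `m⁴ ≥ n³`.

Both refutations `π₁`, `π₂` of the item are consumed (through soundness on `G` and on `Gᶜ`, without which
there is no core), as the standing disproof requires (one-sided variants are false:
`Theorems/RegularResolutionRung/Negative/OneSidedFalse.lean`).
-/

-- the mandated namespace `Summit.PneNP.PneNP.…` (summit = problem = `PneNP`) repeats `PneNP` by design
set_option linter.dupNamespace false

namespace Summit.PneNP.PneNP.Theorems.RamseyUncertifiableResolutionUncertainty

open Literature.Computability.Complexity Literature.Computability.MetaComplexity
open Summit.PneNP.PneNP.Theorems.RegularResolutionRung.Negative (cliqueCNF)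

/-- A `k`-clique of the adjacency table (`f : Fin k → Fin n` with `adj (f i) (f j) = true` for `i ≠ j`;
injectivity is automatic for an irreflexive table and is not needed) satisfies `cliqueCNF n k adj`: set
`x_{i, f i} := 1` and everything else `0`. -/
theorem satisfiable_cliqueCNF_of_clique {n k : ℕ} (adj : Fin n → Fin n → Bool) (f : Fin k → Fin n)
    (hadj : ∀ i j : Fin k, i ≠ j → adj (f i) (f j) = true) :
    (cliqueCNF n k adj).Satisfiable := by
  classical
  let σ : ℕ → Bool := fun w => decide (∃ i : Fin k, (i : ℕ) * n + (f i : ℕ) = w)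
  have hσ : ∀ (i : ℕ) (hi : i < k) (u : Fin n), σ (i * n + (u : ℕ)) = true ↔ f ⟨i, hi⟩ = u := by
    intro i hi u
    simp only [σ, decide_eq_true_eq]
    constructor
    · rintro ⟨i', hi'⟩
      obtain ⟨h1, h2⟩ := blockVar_inj hi'
      have : i' = ⟨i, hi⟩ := Fin.ext h1
      subst this
      exact h2
    · intro h
      exact ⟨⟨i, hi⟩, by rw [h]⟩
  refine ⟨σ, ?_⟩
  simp only [CNF.eval, List.all_eq_true, List.any_eq_true]
  intro c hc
  simp only [cliqueCNF, List.mem_append] at hc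
  rcases hc with (hc | hc) | hc
  · obtain ⟨i, hi, rfl⟩ := List.mem_map.1 hc
    have hi : i < k := List.mem_range.1 hi
    refine ⟨(i * n + ((f ⟨i, hi⟩ : Fin n) : ℕ), true),
      List.mem_map.2 ⟨((f ⟨i, hi⟩ : Fin n) : ℕ), by simp, rfl⟩, ?_⟩
    have := (hσ i hi (f ⟨i, hi⟩)).2 rfl
    simp [Literal.eval, this]
  · obtain ⟨i, hi, hc⟩ := List.mem_flatMap.1 hc
    have hi : i < k := List.mem_range.1 hi
    obtain ⟨u, hu, hc⟩ := List.mem_flatMap.1 hc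
    obtain ⟨v, hv, hc⟩ := List.mem_flatMap.1 hc
    obtain ⟨u, rfl⟩ : ∃ a : Fin n, u = (a : ℕ) := by simpa using hu
    obtain ⟨v, rfl⟩ : ∃ a : Fin n, v = (a : ℕ) := by simpa using hv
    split_ifs at hc with huv
    · have hc : c = [(i * n + (u : ℕ), false), (i * n + (v : ℕ), false)] := List.mem_singleton.1 hc
      subst hc
      by_cases h1 : σ (i * n + (u : ℕ)) = true
      · have hu : f ⟨i, hi⟩ = u := (hσ i hi u).1 h1
        have h2 : σ (i * n + (v : ℕ)) = false := by
          by_contra h2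
          have hv : f ⟨i, hi⟩ = v := (hσ i hi v).1 (by simpa using h2)
          have : (u : ℕ) = v := by rw [← hu, ← hv]
          exact absurd this (ne_of_lt huv)
        exact ⟨(i * n + (v : ℕ), false), by simp, by simp [Literal.eval, h2]⟩
      · exact ⟨(i * n + (u : ℕ), false), by simp, by simpa [Literal.eval] using h1⟩
    · simp at hc
  · obtain ⟨i, hi, hc⟩ := List.mem_flatMap.1 hc
    have hi : i < k := List.mem_range.1 hi
    obtain ⟨j, hj, hc⟩ := List.mem_flatMap.1 hc
    have hj : j < k := List.mem_range.1 hj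
    obtain ⟨u, -, hc⟩ := List.mem_flatMap.1 hc
    obtain ⟨v, -, hc⟩ := List.mem_flatMap.1 hc
    split_ifs at hc with hcond
    · have hc : c = [(i * n + (u : ℕ), false), (j * n + (v : ℕ), false)] := List.mem_singleton.1 hc
      subst hc
      by_cases h1 : σ (i * n + (u : ℕ)) = true
      · have hu : f ⟨i, hi⟩ = u := (hσ i hi u).1 h1
        have h2 : σ (j * n + (v : ℕ)) = false := by
          by_contra h2
          have hv : f ⟨j, hj⟩ = v := (hσ j hj v).1 (by simpa using h2)
          have hne : (⟨i, hi⟩ : Fin k) ≠ ⟨j, hj⟩ := fun h => hcond.1 (Fin.mk.inj_iff.1 h)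
          have := hadj _ _ hne
          rw [hu, hv] at this
          rw [hcond.2] at this
          exact Bool.false_ne_true this
        exact ⟨(j * n + (v : ℕ), false), by simp, by simp [Literal.eval, h2]⟩
      · exact ⟨(i * n + (u : ℕ), false), by simp, by simpa [Literal.eval] using h1⟩
    · simp at hc

/-- Soundness of resolution for this encoding: if `Clique(G, k)` has a resolution refutation then `G` is
`K_k`-free. -/
theorem cliqueFree_of_refutation {n k : ℕ} (G : SimpleGraph (Fin n)) [DecidableRel G.Adj]
    {π : List (ResLine ℕ)} (h : IsResRefutation (cliqueCNF n k fun u v => decide (G.Adj u v)) π) :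
    G.CliqueFree k := by
  intro s hs
  have hcard : s.card = k := hs.card_eq
  let f : Fin k → Fin n := fun i => s.orderEmbOfFin hcard i
  have hf_mem : ∀ i, f i ∈ s := fun i => s.orderEmbOfFin_mem hcard i
  have hf_inj : Function.Injective f := (s.orderEmbOfFin hcard).injective
  refine not_satisfiable_of_isResRefutation_holds h ?_
  refine satisfiable_cliqueCNF_of_clique _ f ?_
  intro i j hij
  have hne : f i ≠ f j := fun h => hij (hf_inj h)
  have hadj : G.Adj (f i) (f j) := hs.isClique (hf_mem i) (hf_mem j) hne
  exact decide_eq_true hadj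

/-- **`ResolutionUncertainty` from bi-dense core hardness** (conditional reduction; the hypothesis is the
open lever of the line `box-dag-self-gadget-lifting`, stated inline). Hypothesis: for all `0 < β < 1`,
`0 < δ` there are `ε > 0`, `m₀` such that for every `m ≥ m₀`, every `k ≤ 3 log₂ m` and every graph `H` on
`Fin m` whose edge density and whose complement's edge density are both `≥ δ` between any two disjoint
vertex sets of size `≥ m^{1-β}`, every resolution refutation of the unary `Clique(H, k)` has length
`≥ m^{ε log₂ m}`. Conclusion: the item. Proof: soundness on both refutations makes `G` 2-Ramsey at
`k = ⌈log₂ n²⌉`; the Prömel–Rödl core (`stub_promelRodl ∘ stub_drcStep`, re-indexed by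
`stub_coreTransfer`) is a bi-dense `H = G.comap e` on `Fin m`, `m⁴ ≥ n³`; `π₁` restricts to the core
without growing (`stub_restrictRefutation`); `k ≤ 3 log₂ m` for `n` large; the hypothesis bounds the
restricted refutation by `m^{ε' log₂ m} ≥ n^{(9/16) ε' log₂ n}`. Constants: `ε := (9/16) ε'`,
`n₀ := max (max n₁ 1) ((max m₀ 256)²)`. -/
theorem resolutionUncertainty_of_biDenseCoreHardness :
    (∀ β δ : ℝ, 0 < β → β < 1 → 0 < δ →
      ∃ ε : ℝ, 0 < ε ∧ ∃ m₀ : ℕ, ∀ m : ℕ, m₀ ≤ m → ∀ k : ℕ, (k : ℝ) ≤ 3 * Real.logb 2 m →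
        ∀ (H : SimpleGraph (Fin m)) [DecidableRel H.Adj],
          (∀ A B : Finset (Fin m), Disjoint A B → (m : ℝ) ^ (1 - β) ≤ A.card → (m : ℝ) ^ (1 - β) ≤ B.card →
            δ ≤ (H.edgeDensity A B : ℝ) ∧ δ ≤ (Hᶜ.edgeDensity A B : ℝ)) →
          ∀ π : List (ResLine ℕ), IsResRefutation (cliqueCNF m k fun u v => decide (H.Adj u v)) π →
            (m : ℝ) ^ (ε * Real.logb 2 m) ≤ π.length) →
    Summit.PneNP.PneNP.Theses.RamseyUncertifiable.ResolutionUncertainty := by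
  intro hHard
  -- the route decl is, definitionally, the `cliqueCNF` statement (its `let`s unfolded)
  show ∃ ε : ℝ, 0 < ε ∧ ∃ n₀ : ℕ, ∀ n ≥ n₀, ∀ (G : SimpleGraph (Fin n)) [DecidableRel G.Adj],
    ∀ π₁ π₂ : List (ResLine ℕ),
      IsResRefutation (cliqueCNF n (Nat.clog 2 (n ^ 2)) fun u v => decide (G.Adj u v)) π₁ →
      IsResRefutation (cliqueCNF n (Nat.clog 2 (n ^ 2)) fun u v => decide (Gᶜ.Adj u v)) π₂ →
      (n : ℝ) ^ (ε * Real.logb 2 n) ≤ max (π₁.length : ℝ) (π₂.length : ℝ)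
  -- the core, re-indexed on `Fin m` (Prömel–Rödl via DRC, then transfer): all proved
  obtain ⟨β, δ, hβ0, hβ1, hδ0, n₁, hcore⟩ := stub_coreTransfer (stub_promelRodl stub_drcStep)
  obtain ⟨ε', hε', m₀, hhard⟩ := hHard β δ hβ0 hβ1 hδ0
  set M₀ : ℕ := max m₀ 256 with hM₀
  refine ⟨9 / 16 * ε', by positivity, max (max n₁ 1) (M₀ ^ 2), ?_⟩
  intro n hn G inst π₁ π₂ h₁ h₂
  -- bookkeeping on `n`
  have hn₁ : n₁ ≤ n := le_trans (le_trans (le_max_left _ _) (le_max_left _ _)) hn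
  have hn1 : 1 ≤ n := le_trans (le_trans (le_max_right _ _) (le_max_left _ _)) hn
  have hnM : M₀ ^ 2 ≤ n := le_trans (le_max_right _ _) hn
  set k : ℕ := Nat.clog 2 (n ^ 2) with hk
  -- both sides are `K_k`-free by soundness, so the core exists
  have hfree : G.CliqueFree k := cliqueFree_of_refutation G h₁
  have hfreeC : Gᶜ.CliqueFree k := cliqueFree_of_refutation Gᶜ h₂
  obtain ⟨m, e, hnm, hdense⟩ := hcore n hn₁ G hfree hfreeC
  -- restrict `π₁` to the core
  obtain ⟨π₁', h₁', hlen⟩ := stub_restrictRefutation n m k (fun u v => decide (G.Adj u v)) e π₁ h₁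
  -- `m` is large
  have hmM : M₀ ≤ m := by
    by_contra hlt
    push Not at hlt
    have h4 : m ^ 4 < M₀ ^ 4 := Nat.pow_lt_pow_left hlt (by norm_num)
    have h5 : M₀ ^ 4 ≤ n ^ 2 := by
      calc M₀ ^ 4 = (M₀ ^ 2) ^ 2 := by ring
        _ ≤ n ^ 2 := Nat.pow_le_pow_left hnM 2
    have h6 : n ^ 2 ≤ n ^ 3 := Nat.pow_le_pow_right hn1 (by norm_num)
    omega
  have hm₀ : m₀ ≤ m := le_trans (le_max_left _ _) hmM
  have hm256 : 256 ≤ m := le_trans (le_max_right _ _) hmM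
  have hm1 : 1 ≤ m := le_trans (by norm_num) hm256
  have hmpos : (0 : ℝ) < m := by exact_mod_cast (lt_of_lt_of_le Nat.zero_lt_one hm1)
  have hnpos : (0 : ℝ) < n := by exact_mod_cast (lt_of_lt_of_le Nat.zero_lt_one hn1)
  -- `k ≤ 3 log₂ m`
  set c : ℕ := Nat.log 2 m with hc
  have hc8 : 8 ≤ c := by
    rw [hc]
    exact Nat.le_log_of_pow_le (by norm_num) (by simpa using hm256)
  have hm_lt : m < 2 ^ (c + 1) := Nat.lt_pow_succ_log_self (by norm_num) m
  have hk3c : k ≤ 3 * c := by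
    apply Nat.clog_le_of_le_pow
    have h8 : m ^ 8 < 2 ^ (9 * c) := by
      calc m ^ 8 < (2 ^ (c + 1)) ^ 8 := Nat.pow_lt_pow_left hm_lt (by norm_num)
        _ = 2 ^ (8 * c + 8) := by rw [← pow_mul]; ring_nf
        _ ≤ 2 ^ (9 * c) := Nat.pow_le_pow_right (by norm_num) (by omega)
    have h6 : (n ^ 2) ^ 3 < (2 ^ (3 * c)) ^ 3 := by
      calc (n ^ 2) ^ 3 = (n ^ 3) ^ 2 := by ring
        _ ≤ (m ^ 4) ^ 2 := Nat.pow_le_pow_left hnm 2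
        _ = m ^ 8 := by ring
        _ < 2 ^ (9 * c) := h8
        _ = (2 ^ (3 * c)) ^ 3 := by rw [← pow_mul]; ring_nf
    exact le_of_lt (lt_of_pow_lt_pow_left₀ 3 (Nat.zero_le _) h6)
  have hclog : (c : ℝ) ≤ Real.logb 2 m := by
    rw [Real.le_logb_iff_rpow_le (by norm_num) hmpos, Real.rpow_natCast]
    exact_mod_cast Nat.pow_log_le_self 2 (by omega : m ≠ 0)
  have hk3 : (k : ℝ) ≤ 3 * Real.logb 2 m := by
    calc (k : ℝ) ≤ ((3 * c : ℕ) : ℝ) := by exact_mod_cast hk3c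
      _ = 3 * (c : ℝ) := by push_cast; ring
      _ ≤ 3 * Real.logb 2 m := by linarith
  -- the hypothesis on the core
  have hcoreLB : (m : ℝ) ^ (ε' * Real.logb 2 m) ≤ π₁'.length :=
    hhard m hm₀ k hk3 (G.comap e) hdense π₁' h₁'
  -- compare exponents: `n^{(9/16) ε' log₂ n} ≤ m^{ε' log₂ m}`
  have hx0 : 0 ≤ Real.logb 2 n := Real.logb_nonneg (by norm_num) (by exact_mod_cast hn1)
  have h34 : 3 * Real.logb 2 n ≤ 4 * Real.logb 2 m := by
    have hcast : ((n : ℝ)) ^ 3 ≤ ((m : ℝ)) ^ 4 := by exact_mod_cast hnm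
    have := (Real.logb_le_logb (b := 2) (by norm_num) (by positivity) (by positivity)).2 hcast
    rwa [Real.logb_pow, Real.logb_pow] at this
  have hexp : Real.logb 2 n * (9 / 16 * ε' * Real.logb 2 n) ≤ Real.logb 2 m * (ε' * Real.logb 2 m) := by
    have hA : 0 ≤ 4 * Real.logb 2 m - 3 * Real.logb 2 n := by linarith
    have hB : 0 ≤ 4 * Real.logb 2 m + 3 * Real.logb 2 n := by linarith
    have hC : 0 ≤ (4 * Real.logb 2 m - 3 * Real.logb 2 n) * (4 * Real.logb 2 m + 3 * Real.logb 2 n) * ε' :=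
      mul_nonneg (mul_nonneg hA hB) hε'.le
    nlinarith [hC]
  have hmain : (n : ℝ) ^ (9 / 16 * ε' * Real.logb 2 n) ≤ (m : ℝ) ^ (ε' * Real.logb 2 m) := by
    have hn' : (2 : ℝ) ^ Real.logb 2 n = n := Real.rpow_logb (by norm_num) (by norm_num) hnpos
    have hm' : (2 : ℝ) ^ Real.logb 2 m = m := Real.rpow_logb (by norm_num) (by norm_num) hmpos
    calc (n : ℝ) ^ (9 / 16 * ε' * Real.logb 2 n)
        = ((2 : ℝ) ^ Real.logb 2 n) ^ (9 / 16 * ε' * Real.logb 2 n) := by rw [hn']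
      _ = (2 : ℝ) ^ (Real.logb 2 n * (9 / 16 * ε' * Real.logb 2 n)) := by
          rw [← Real.rpow_mul (by norm_num)]
      _ ≤ (2 : ℝ) ^ (Real.logb 2 m * (ε' * Real.logb 2 m)) :=
          Real.rpow_le_rpow_of_exponent_le (by norm_num) hexp
      _ = ((2 : ℝ) ^ Real.logb 2 m) ^ (ε' * Real.logb 2 m) := by
          rw [← Real.rpow_mul (by norm_num)]
      _ = (m : ℝ) ^ (ε' * Real.logb 2 m) := by rw [hm']
  -- assemble
  calc (n : ℝ) ^ (9 / 16 * ε' * Real.logb 2 n)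
      ≤ (m : ℝ) ^ (ε' * Real.logb 2 m) := hmain
    _ ≤ π₁'.length := hcoreLB
    _ ≤ π₁.length := by exact_mod_cast hlen
    _ ≤ max (π₁.length : ℝ) (π₂.length : ℝ) := le_max_left _ _

end Summit.PneNP.PneNP.Theorems.RamseyUncertifiableResolutionUncertainty
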